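import Summits.Ventures.PercRepro.Night2FatXFreePointGeom

/-!
# night-2: the fat case with bounded lines and generic off-points — a free point exists for `|G| ≥ 6t + 8`

If every line of `V` has at most `t + 2` points, a basis line `ℓ_ab` carries at most `t` points of `W ∖ {x}`
(`card_filter_line_le`), so the six basis lines carry at most `6t` of them and `W ∖ {x}` has a point off every basis
line as soon as `|W ∖ {x}| ≥ 6t + 1` (`exists_free_point_of_lines_le`).  With generic off-points that point is a free
point (`dload_eq_zero_of_free_of_generic`) and `basis_pair_fair_fat_of_free_point_generic` applies (`N ≥ 8`):
**`localShadowHall_fat_of_lines_le_of_generic`** — the (2,1) cell with a fat closure, no `t + 3` collinear points off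
`K` (`t ≥ 1`), generic off-points and `|G| ≥ 6t + 8` satisfies the local Hall inequality (`t = 1`: no four collinear,
`|G| ≥ 14`; `t = 2`: no five collinear, `|G| ≥ 20`; …; `t = 0` is the no-triangle case `localShadowHall_fat_of_no_triangle`).  Paper `proofs/NIGHT-2-g33.md` §6 (d).
-/

namespace PercRepro.Shadow

open PercRepro.ThmH PercRepro.PerFlat

variable {α : Type*} [DecidableEq α] {M : Matroid α} [M.Finite] {G : Finset α}

open scoped Classical in
/-- **A basis line carries at most `t` points of `W ∖ {x}`** when every line of `V` has at most `t + 2` points. -/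
theorem card_filter_line_le (hG : G ∈ flatsQ M (5 + 1)) (hd : (gr M \ G).card = 2)
    (hs : ∀ e ∈ gr M, ∀ f ∈ gr M, e ≠ f → rkN M {e, f} = 2) {t : ℕ}
    (htri : ∀ R ⊆ G \ coloops M G, rkN M R = 2 → R.card ≤ t + 2) {B : Finset α} (hB : B ∈ thinMembers M 5 G)
    {z : α} (hz : z ∈ G \ clF M B) {x : α} {a b : α} (ha : a ∈ insert z B \ coloops M G)
    (hb : b ∈ insert z B \ coloops M G) (hab : a ≠ b) :
    (((G \ insert z B).erase x).filter (fun y => rkN M (insert y {a, b}) ≤ 2)).card ≤ t := by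
  have hGg : G ⊆ gr M := (mem_flatsQ.1 hG).1
  have hd' : (gr M \ G).card ≤ 5 := by omega
  have hQG : insert z B ⊆ G :=
    Finset.insert_subset (Finset.mem_sdiff.1 hz).1 (subset_G_of_mem_thinMembers hB)
  have hKQ : coloops M G ⊆ insert z B :=
    (coloops_subset_of_mem_thinMembers hG hd' hB).trans (Finset.subset_insert _ _)
  set W := ((G \ insert z B).erase x).filter (fun y => rkN M (insert y {a, b}) ≤ 2) with hW
  have haG : a ∈ G := hQG (Finset.mem_sdiff.1 ha).1
  have hbG : b ∈ G := hQG (Finset.mem_sdiff.1 hb).1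
  have hWmem : ∀ e ∈ W, e ∈ G ∧ e ∉ insert z B ∧ rkN M (insert e {a, b}) ≤ 2 := by
    intro e he
    rw [hW, Finset.mem_filter, Finset.mem_erase, Finset.mem_sdiff] at he
    exact ⟨he.1.2.1, he.1.2.2, he.2⟩
  have haW : a ∉ W := fun h => (hWmem a h).2.1 (Finset.mem_sdiff.1 ha).1
  have hbW : b ∉ W := fun h => (hWmem b h).2.1 (Finset.mem_sdiff.1 hb).1
  set S := insert a (insert b W) with hS
  have hSV : S ⊆ G \ coloops M G := by
    intro e he
    rw [hS, Finset.mem_insert, Finset.mem_insert] at he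
    rcases he with rfl | rfl | he
    · exact Finset.sdiff_subset_sdiff hQG (Finset.Subset.refl _) ha
    · exact Finset.sdiff_subset_sdiff hQG (Finset.Subset.refl _) hb
    · obtain ⟨heG, heQ, -⟩ := hWmem e he
      exact Finset.mem_sdiff.2 ⟨heG, fun hK => heQ (hKQ hK)⟩
  have hSgr : S ⊆ gr M := hSV.trans (Finset.sdiff_subset.trans hGg)
  have hpair : ({a, b} : Finset α) ⊆ gr M := by
    intro e he
    rw [Finset.mem_insert, Finset.mem_singleton] at he
    rcases he with rfl | rfl
    · exact hGg haG
    · exact hGg hbG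
  have hScl : S ⊆ clF M {a, b} := by
    intro e he
    rw [hS, Finset.mem_insert, Finset.mem_insert] at he
    rcases he with rfl | rfl | he
    · exact subset_clF_of_subset_gr hpair (Finset.mem_insert_self _ _)
    · exact subset_clF_of_subset_gr hpair (Finset.mem_insert_of_mem (Finset.mem_singleton_self _))
    · obtain ⟨heG, -, hrk⟩ := hWmem e he
      have heq : insert e {a, b} = ({a, b, e} : Finset α) := by
        ext u
        simp only [Finset.mem_insert, Finset.mem_singleton]
        tauto
      rw [heq] at hrk
      exact mem_clF_pair_of_rkN_le_two hG hs haG hbG heG hab.symm hrk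
  have hrk2 : rkN M S = 2 := by
    have h1 : rkN M S ≤ 2 := by
      have := rkN_mono (M := M) hScl
      rw [rkN_clF, hs a (hGg haG) b (hGg hbG) hab] at this
      exact this
    have h2 : 2 ≤ rkN M S := rkN_pair_eq_two hs hSgr (Finset.mem_insert_self _ _)
      (Finset.mem_insert_of_mem (Finset.mem_insert_self _ _)) hab
    omega
  have hcard := htri S hSV hrk2
  rw [hS, Finset.card_insert_of_notMem, Finset.card_insert_of_notMem hbW] at hcard
  · omega
  · rw [Finset.mem_insert, not_or]
    exact ⟨hab, haW⟩

open scoped Classical in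
/-- **A point of `W ∖ {x}` off every basis line exists** when `|W ∖ {x}| ≥ 6t + 1` and every line of `V` has at most
`t + 2` points. -/
theorem exists_free_point_of_lines_le (hG : G ∈ flatsQ M (5 + 1)) (hd : (gr M \ G).card = 2)
    (hk : kColoops M G = 1) (hs : ∀ e ∈ gr M, ∀ f ∈ gr M, e ≠ f → rkN M {e, f} = 2) {t : ℕ}
    (htri : ∀ R ⊆ G \ coloops M G, rkN M R = 2 → R.card ≤ t + 2) {B : Finset α} (hB : B ∈ thinMembers M 5 G)
    (hnP : ¬ bigP M G B) {z : α} (hz : z ∈ G \ clF M B) {w₀ x : α} (hw₀ : w₀ ∈ insert z B \ coloops M G)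
    (hm : 6 * t + 1 ≤ ((G \ insert z B).erase x).card) :
    ∃ y ∈ (G \ insert z B).erase x, ∀ a ∈ (insert z B \ coloops M G).erase w₀,
      ∀ b ∈ (insert z B \ coloops M G).erase w₀, a ≠ b → rkN M {a, b, y} = 3 := by
  have hGg : G ⊆ gr M := (mem_flatsQ.1 hG).1
  have hQG : insert z B ⊆ G :=
    Finset.insert_subset (Finset.mem_sdiff.1 hz).1 (subset_G_of_mem_thinMembers hB)
  set P₀ := (insert z B \ coloops M G).erase w₀ with hP₀
  have hP₀4 : P₀.card = 4 := by
    rw [hP₀, Finset.card_erase_of_mem hw₀, card_insert_sdiff_eq_five hG hd hk hB hnP hz]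
  set W' := (G \ insert z B).erase x with hW'
  set Bad := W'.filter (fun y => ∃ a ∈ P₀, ∃ b ∈ P₀, a ≠ b ∧ rkN M {a, b, y} ≤ 2) with hBad
  have hBadsub : Bad ⊆ (P₀.powersetCard 2).biUnion
      (fun s => W'.filter (fun y => rkN M (insert y s) ≤ 2)) := by
    intro y hy
    rw [hBad, Finset.mem_filter] at hy
    obtain ⟨hyW, a, ha, b, hb, hab, hrk⟩ := hy
    rw [Finset.mem_biUnion]
    refine ⟨{a, b}, Finset.mem_powersetCard.2 ⟨?_, Finset.card_pair hab⟩, Finset.mem_filter.2 ⟨hyW, ?_⟩⟩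
    · intro e he
      rw [Finset.mem_insert, Finset.mem_singleton] at he
      rcases he with rfl | rfl
      · exact ha
      · exact hb
    · have heq : insert y {a, b} = ({a, b, y} : Finset α) := by
        ext u
        simp only [Finset.mem_insert, Finset.mem_singleton]
        tauto
      rw [heq]
      exact hrk
  have hBadcard : Bad.card ≤ 6 * t := by
    refine le_trans (Finset.card_le_card hBadsub) (le_trans Finset.card_biUnion_le ?_)
    have h6 : (P₀.powersetCard 2).card = 6 := by
      rw [Finset.card_powersetCard, hP₀4]
      decide
    calc ∑ s ∈ P₀.powersetCard 2, (W'.filter (fun y => rkN M (insert y s) ≤ 2)).card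
        ≤ ∑ _s ∈ P₀.powersetCard 2, t := by
          apply Finset.sum_le_sum
          intro s hs'
          rw [Finset.mem_powersetCard] at hs'
          obtain ⟨a, b, hab, rfl⟩ := Finset.card_eq_two.1 hs'.2
          have ha : a ∈ insert z B \ coloops M G :=
            Finset.mem_of_mem_erase (hs'.1 (Finset.mem_insert_self _ _))
          have hb : b ∈ insert z B \ coloops M G :=
            Finset.mem_of_mem_erase (hs'.1 (Finset.mem_insert_of_mem (Finset.mem_singleton_self _)))
          exact card_filter_line_le hG hd hs htri hB hz ha hb hab
      _ = 6 * t := by rw [Finset.sum_const, h6, smul_eq_mul]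
  have hBadW : Bad ⊆ W' := by
    rw [hBad]
    exact Finset.filter_subset _ _
  have hex : (W' \ Bad).Nonempty := by
    rw [← Finset.card_pos, Finset.card_sdiff_of_subset hBadW]
    omega
  obtain ⟨y, hy⟩ := hex
  rw [Finset.mem_sdiff] at hy
  refine ⟨y, hy.1, ?_⟩
  intro a ha b hb hab
  have hnot : ¬ rkN M {a, b, y} ≤ 2 := by
    intro h
    exact hy.2 (Finset.mem_filter.2 ⟨hy.1, a, ha, b, hb, hab, h⟩)
  have h3 : rkN M {a, b, y} ≤ 3 := le_trans (rkN_le_card _) (Finset.card_le_three)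
  omega

/-- **The (2,1) cell with a fat closure, no `t + 3` collinear points off `K`, generic off-points and `|G| ≥ 6t + 8`.** -/
theorem localShadowHall_fat_of_lines_le_of_generic (hG : G ∈ flatsQ M (5 + 1)) (hd : (gr M \ G).card = 2)
    (hk : kColoops M G = 1) (hs : ∀ e ∈ gr M, ∀ f ∈ gr M, e ≠ f → rkN M {e, f} = 2)
    (hl : ∀ e ∈ gr M, M.Indep {e}) (hfat : (fatClosures M 5 G 2).card ≤ 1)
    {B₀ : Finset α} (hB₀ : B₀ ∈ thinMembers M 5 G) (hm₀ : (G \ clF M B₀).card = 2) {t : ℕ} (ht : 1 ≤ t)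
    (htri : ∀ R ⊆ G \ coloops M G, rkN M R = 2 → R.card ≤ t + 2)
    (hgen : ∀ R ⊆ G \ coloops M G, rkN M R = 2 → 3 ≤ R.card → 4 ≤ rkN M (R ∪ (G \ clF M B₀)))
    (hGt : 6 * t + 8 ≤ G.card) : LocalShadowHall M 5 G := by
  apply localShadowHall_of_gt2_of_basis_fair hG hd hk hs hl hfat
  intro B hB hnP z hz
  have hd' : (gr M \ G).card ≤ 5 := by omega
  have hGg : G ⊆ gr M := (mem_flatsQ.1 hG).1
  by_cases hl0 : loss M 5 G B z = 0
  · rw [hl0]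
    have h1 : 0 ≤ rhoL M 5 G B z := by
      unfold rhoL
      rw [hl0]
      simp
    have h2 : 0 ≤ lossIncomeH M 5 G (bigP M G) (dshGT2 M 5 G) B z :=
      lossIncomeH_nonneg hG hd' (column_side_gt2 hG hd hk hs hl hfat) B z
    positivity
  · obtain ⟨w₀, x, hD, hne, hw₀, hx⟩ := exists_fat_split hG hd hk hB₀ hm₀ hB hz hl0
    have hgen' : ∀ R ⊆ G \ coloops M G, rkN M R = 2 → 3 ≤ R.card → 4 ≤ rkN M (insert w₀ (insert x R)) := by
      intro R hR hR2 hR3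
      have := hgen R hR hR2 hR3
      rw [hD] at this
      have heq : R ∪ ({w₀, x} : Finset α) = insert w₀ (insert x R) := by
        ext e
        simp only [Finset.mem_union, Finset.mem_insert, Finset.mem_singleton]
        tauto
      rw [heq] at this
      exact this
    have hw₀K : w₀ ∉ coloops M G := by
      intro h'
      have h1 : w₀ ∈ clF M B₀ := subset_clF_of_subset_gr ((subset_G_of_mem_thinMembers hB₀).trans hGg)
        (coloops_subset_of_mem_thinMembers hG hd' hB₀ h')
      have h2 : w₀ ∈ G \ clF M B₀ := by
        rw [hD]
        exact Finset.mem_insert_self _ _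
      exact (Finset.mem_sdiff.1 h2).2 h1
    have hxG : x ∈ G \ insert z B := by
      refine Finset.mem_sdiff.2 ⟨?_, hx⟩
      have : x ∈ G \ clF M B₀ := by
        rw [hD]
        exact Finset.mem_insert_of_mem (Finset.mem_singleton_self _)
      exact (Finset.mem_sdiff.1 this).1
    have hN : 6 * t + 2 ≤ (G \ insert z B).card := by
      have hQG : insert z B ⊆ G :=
        Finset.insert_subset (Finset.mem_sdiff.1 hz).1 (subset_G_of_mem_thinMembers hB)
      have hKQ : coloops M G ⊆ insert z B :=
        (coloops_subset_of_mem_thinMembers hG hd' hB).trans (Finset.subset_insert _ _)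
      have hQ5 := card_insert_sdiff_eq_five hG hd hk hB hnP hz
      have h1 := Finset.card_sdiff_add_card_eq_card hKQ
      rw [← kColoops_eq_card_coloops, hk, hQ5] at h1
      have h2 := Finset.card_sdiff_add_card_eq_card hQG
      omega
    have hm : 6 * t + 1 ≤ ((G \ insert z B).erase x).card := by
      rw [Finset.card_erase_of_mem hxG]
      omega
    obtain ⟨y, hy, hfree⟩ := exists_free_point_of_lines_le hG hd hk hs htri hB hnP hz
      (Finset.mem_sdiff.2 ⟨hw₀, hw₀K⟩) hm
    exact basis_pair_fair_fat_of_free_point_generic hG hd hk hs hl hfat hB₀ hD hne hgen' hB hnP hz hl0 hw₀ hx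
      (Finset.mem_of_mem_erase hy) (fun h' => (Finset.mem_erase.1 hy).1 h'.symm) (by omega) hfree

end PercRepro.Shadow
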